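import Summits.BirchSwinnertonDyer.Rank1Residual.SecondDescent.NonemptyCasselsTateFree
import HarnessLib

/-!
# B-1 second-3-descent `NONEMPTY × 2` record SHAPES for a literal model at good supersingular `3`, classes X8 / X7, NO Cassels–Tate, `hcard`-free (cell `b2b-bsdres`, supersingular family prover B = unit `b2b-bsdres-additive-p3`, GEN 26; CLASS-CLOSURE class lead N6·O3, X7 joint B)

HONEST FRAMING (run/shared/lean/b2b/bsd-rank1-residual/, verbatim in every file): the goal of the
cell is to DELETE the COMBINATION-SHAPED residual classes of the Birch–Swinnerton-Dyer formula for
ALL analytic-rank `≤ 1` elliptic curves over `ℚ` — "full BSD formula for every rank `≤ 1` curve in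
class `C`" assembled STRICTLY from published theorems — so that the rank-`≤ 1` remainder becomes
exactly the CONSTRUCTION-SHAPED classes, which are TYPED (missing-input `Prop`s), NOT attempted.
This is not "finishing BSD". Classes X7 / X8 stay CONSTRUCTION-SHAPED; these are per-pair record
SHAPES (certificate consumers); the second-descent outputs that instantiate them are
INSTRUMENTATION (class-closure E4) / EVIDENCE under census-lead's tier label; no lane verdict is
changed; no named fact is added; nothing is booked by this unit. THEOREMS ONLY (no definition, no
named fact, no `sorry`).

## What this file does

`SecondDescent/NonemptyCasselsTateFree.lean` (cc-eng-4 GEN 17, §2–§3) proved the `p = 3`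
consumers `X8.bsdp_three_rankZero_of_two_nonempty_of_surj` / `X7.…` (Wuthrich 2014 Prop. 21 upper
half + GZK + modularity + two `3`-torsion classes `c₁ ≠ 0`, `c₂ ∉ ℤ∙c₁` of `Ш` that are BOTH third
multiples + `ord₃ #Ш_an ≤ 4` ⟹ `BSD(E,3)`; NO Cassels–Tate pairing, NO `#Ш[3] = 9` binder) and the
LITERAL-MODEL wrapper for X6 only (`X6.bsdp_three_rankZero_of_ainvs_of_two_nonempty`, used by the
N4@3 canary records `bsdp3_b1n_…''`).  This file adds the two missing literal-model wrappers, for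
X8 and X7 (the classes of the 44 `#Ш_an = 81·u` rows of `B1-ASK-SHA81`, class-closure folders N6 =
X8 r0 (33) and N5@3 = X7 r0 (11)): the instances `IsElliptic` (from `discOf ≠ 0`) and
`IsGloballyMinimal` (a kernel certificate) are manufactured from the literal data, exactly as in the
X6 wrapper, so that a record is ONE `exact` with cc-eng-4's pre-landed kernel certificates
`isGloballyMinimal_s<label>` / `classX8_s<label>` (`classX7_s<label>`) / `surj3_s<label>`
(`Sha81TargetsKernelCertificatesS00–S05`, `KrausGeneralTwoTargetsKernelCertificatesA`).  What a
record then displays as binders: the named facts `hW` (Wuthrich Prop. 21), `hGZK`, `hmod` — all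
PUBLISHED —, the analytic data `hr` (`r_an = 0`), `hq`/`hv` (`#Ш_an`), and the certificate itself
(`h1 h2 hc₁ hind hd₁ hd₂`: two independent `Sel₃` classes, both `NONEMPTY(witness)` on two
implementations of Creutz's second `3`-descent, cross-verified).  Per pair; classes unchanged;
nothing booked.  References: C. Wuthrich, Doc. Math. 19 (2014) Prop. 21 [Wuthrich2014]; B. Creutz,
Math. Comp. 83 (2014) §1, §7 [Creutz2014]; J. H. Silverman, *AEC* VII.1, X.4 [SilvermanAEC2009];
R. L. Miller, LMS JCM 14 (2011) §1 [Miller2011LMS]; J.-P. Serre, Invent. Math. 15 (1972) [Serre1972].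
-/

set_option autoImplicit false

noncomputable section

open scoped Classical

open WeierstrassCurve Literature.NumberTheory.EllipticCurves
  Literature.NumberTheory.EllipticCurves.ModularForms
  Literature.NumberTheory.EllipticCurves.Rank1Residual
  Literature.NumberTheory.EllipticCurves.Rank1Residual.Typed
  Literature.NumberTheory.EllipticCurves.Rank1Residual.X11RankOneCertificates
  Literature.NumberTheory.EllipticCurves.Wuthrich2014
  Summit.BirchSwinnertonDyer.BirchSwinnertonDyer.Rank1Residual.IntModel
  Summit.BirchSwinnertonDyer.Rank1Residual.X11b

namespace Summit.BirchSwinnertonDyer.Rank1Residual.SecondDescent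

/-- **X8 ∩ {r_an = 0} ∩ {surj(3)}, literal model, `Ш` currency, NO Cassels–Tate, `hcard`-free**:
Wuthrich's upper half + GZK + modularity + [global minimality, X8 at `3`, `ρ̄_{E,3}` onto — kernel
certificates of the literal model] + `r_an = 0` + two `3`-torsion classes `c₁ ≠ 0`, `c₂ ∉ ℤ∙c₁` of
`Ш`, BOTH third multiples (the two `NONEMPTY` second-descent witnesses) + `ord₃ #Ш_an ≤ 4` ⟹
`BSD(E,3)` (= `X8.bsdp_three_rankZero_of_two_nonempty_of_surj` of `NonemptyCasselsTateFree` with the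
instances manufactured from the literal data). Per pair; class X8 unchanged; nothing booked.
[cite: Wuthrich2014, Prop. 21 (p. 400)] [cite: Creutz2014, §1 and §7]
[cite: SilvermanAEC2009, Thm. X.4.2(a)] [cite: Miller2011LMS, §1 and Def. 1.1] -/
theorem X8.bsdp_three_rankZero_of_ainvs_of_two_nonempty_of_surj (hW : sha_dvd_analyticSha)
    (hGZK : rank_eq_analyticRank_of_analyticRank_le_one) (hmod : hasEntireLFunction_rat)
    (a1 a2 a3 a4 a6 : ℤ) (hΔ : discOf [a1, a2, a3, a4, a6] ≠ 0)
    (hmin : (⟨a1, a2, a3, a4, a6⟩ : WeierstrassCurve ℚ).IsGloballyMinimal)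
    (hX : haveI := hmin; ClassX8 (⟨a1, a2, a3, a4, a6⟩ : WeierstrassCurve ℚ) 3)
    (hs : Surj (⟨a1, a2, a3, a4, a6⟩ : WeierstrassCurve ℚ) 3)
    (hr : (⟨a1, a2, a3, a4, a6⟩ : WeierstrassCurve ℚ).analyticRank = 0)
    {c₁ c₂ d₁ d₂ : (⟨a1, a2, a3, a4, a6⟩ : WeierstrassCurve ℚ).sha} (h1 : 3 • c₁ = 0)
    (h2 : 3 • c₂ = 0) (hc₁ : c₁ ≠ 0) (hind : c₂ ∉ AddSubgroup.zmultiples c₁) (hd₁ : 3 • d₁ = c₁)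
    (hd₂ : 3 • d₂ = c₂)
    {q : ℚ} (hq : shaAn (⟨a1, a2, a3, a4, a6⟩ : WeierstrassCurve ℚ) = (q : ℂ))
    (hv : padicValRat 3 q ≤ 4) : BSDp (⟨a1, a2, a3, a4, a6⟩ : WeierstrassCurve ℚ) 3 := by
  haveI := isElliptic_of_discOf_ne_zero a1 a2 a3 a4 a6 hΔ
  haveI := hmin
  exact X8.bsdp_three_rankZero_of_two_nonempty_of_surj hW hGZK hmod _ hX hs hr h1 h2 hc₁ hind hd₁
    hd₂ hq hv

/-- **X7 ∩ {r_an = 0}, surj(3) (per-pair datum), literal model, `Ш` currency, NO Cassels–Tate,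
`hcard`-free**: Wuthrich's upper half + GZK + modularity + [global minimality, X7 at `3`, `ρ̄_{E,3}`
onto — kernel certificates of the literal model] + `r_an = 0` + two independent `3`-torsion classes
of `Ш` BOTH third multiples + `ord₃ #Ш_an ≤ 4` ⟹ `BSD(E,3)` (= `X7.bsdp_three_rankZero_of_two_nonempty_of_surj`
of `NonemptyCasselsTateFree` on the literal model). Per pair; class X7 unchanged; nothing booked.
[cite: Wuthrich2014, Prop. 21 (p. 400)] [cite: Creutz2014, §1 and §7]
[cite: SilvermanAEC2009, Thm. X.4.2(a)] [cite: Miller2011LMS, §1 and Def. 1.1] -/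
theorem X7.bsdp_three_rankZero_of_ainvs_of_two_nonempty_of_surj (hW : sha_dvd_analyticSha)
    (hGZK : rank_eq_analyticRank_of_analyticRank_le_one) (hmod : hasEntireLFunction_rat)
    (a1 a2 a3 a4 a6 : ℤ) (hΔ : discOf [a1, a2, a3, a4, a6] ≠ 0)
    (hmin : (⟨a1, a2, a3, a4, a6⟩ : WeierstrassCurve ℚ).IsGloballyMinimal)
    (hX : haveI := hmin; ClassX7 (⟨a1, a2, a3, a4, a6⟩ : WeierstrassCurve ℚ) 3)
    (hs : Surj (⟨a1, a2, a3, a4, a6⟩ : WeierstrassCurve ℚ) 3)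
    (hr : (⟨a1, a2, a3, a4, a6⟩ : WeierstrassCurve ℚ).analyticRank = 0)
    {c₁ c₂ d₁ d₂ : (⟨a1, a2, a3, a4, a6⟩ : WeierstrassCurve ℚ).sha} (h1 : 3 • c₁ = 0)
    (h2 : 3 • c₂ = 0) (hc₁ : c₁ ≠ 0) (hind : c₂ ∉ AddSubgroup.zmultiples c₁) (hd₁ : 3 • d₁ = c₁)
    (hd₂ : 3 • d₂ = c₂)
    {q : ℚ} (hq : shaAn (⟨a1, a2, a3, a4, a6⟩ : WeierstrassCurve ℚ) = (q : ℂ))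
    (hv : padicValRat 3 q ≤ 4) : BSDp (⟨a1, a2, a3, a4, a6⟩ : WeierstrassCurve ℚ) 3 := by
  haveI := isElliptic_of_discOf_ne_zero a1 a2 a3 a4 a6 hΔ
  haveI := hmin
  exact X7.bsdp_three_rankZero_of_two_nonempty_of_surj hW hGZK hmod _ hX hs hr h1 h2 hc₁ hind hd₁
    hd₂ hq hv

end Summit.BirchSwinnertonDyer.Rank1Residual.SecondDescent

end
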